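import Summits.Ventures.PercRepro.C041TriDomCycleDomination
import Summits.Ventures.PercRepro.C041TriDomGlueMainS

/-!
# ROW C-041 — THE SIBLING DOMINATION ON EVERY CYCLE HOST
(p6, gen 45; P6-TWOEXIT-LEAN.md §53 ADDENDUM 16, THEOREM (CYCLES))

Marks `x = 0`, `y = p` and the terminal `t = q` on the cycle, arcs `a = [0, p)`, `b = [p, q)`, `c = [q, m + 1)`.
The sibling's classes on the cycle are (`sibSrc_cycle_iff`) «`a` red, `c` blue, `b` mixed» (`arcA`), «`a` blue, `b`
red, `c` mixed» (`arcC`), «`a` blue, `b` red, `c` blue» (`arcD`, the pattern `(B,B,D)`) and «`a` red, `b` red,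
`c` blue» (`arcE`, the pattern `(R,D,R)`, common to source and target); the target is `(⊤, ⊥)` or «`a` red, `c`
red, `b` blue» (`arcF`) or `arcE` (`sibTop_cycle_iff`).  **THE SIBLING FLIP** (`sibFlip`): `arcA` flips `c`, `arcC`
flips `a`, `arcD` flips `a` and `c` (to all red), `arcE` stays.  Red-ward, into the target, injective (the images
keep `b` mixed, `c` mixed, are all red, keep `c` blue — pairwise distinguishable).  Hence the sibling domination
holds on every cycle host (`sibDominationS_cycle`); with THEOREM (CYCLES) for the conjecture and the reduction of
ADDENDUM 16 this gives THEOREM (CACTI) on paper.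
-/

namespace PercRepro

namespace ZoneZ

namespace MultiExit

open ZoneData Finset

variable {m : ℕ} (p q : Fin (m + 1)) (hp : 0 < p.val) (hpq : p.val < q.val)

/-- «`a` blue, `b` red, `c` blue» (the pattern `(B,B,D)`). -/
def arcD (ω : Fin (m + 1) → Bool) : Prop :=
  Mono false 0 p.val ω ∧ Mono true p.val q.val ω ∧ Mono false q.val (m + 1) ω

/-- «`a` red, `b` red, `c` blue» (the pattern `(R,D,R)`). -/
def arcE (ω : Fin (m + 1) → Bool) : Prop :=
  Mono true 0 p.val ω ∧ Mono true p.val q.val ω ∧ Mono false q.val (m + 1) ω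

/-- «`a` red, `c` red, `b` blue» (the pattern `(R,R,D)`). -/
def arcF (ω : Fin (m + 1) → Bool) : Prop :=
  Mono true 0 p.val ω ∧ Mono false p.val q.val ω ∧ Mono true q.val (m + 1) ω

include hp hpq in
/-- The sibling's classes on the cycle. -/
theorem sibSrc_cycle_iff (ω : Fin (m + 1) → Bool) :
    (SibC₁ (cycleHost m) 0 p q (fun _ => EStat.free) ω ∨ SibC₃ (cycleHost m) 0 p q (fun _ => EStat.free) ω) ↔
      arcA p q ω ∨ arcC p q ω ∨ arcD p q ω ∨ arcE p q ω := by
  unfold SibC₁ SibC₃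
  obtain ⟨h1, h2, h3, h4, h5, h6⟩ := cycle_atoms p q hp hpq ω
  rw [h1, h2, h3, h4, h5, h6]
  unfold arcA arcC arcD arcE
  have na : ¬ (Mono true 0 p.val ω ∧ Mono false 0 p.val ω) := fun h =>
    not_mono_both ω hp (by omega) h.1 h.2
  have nb : ¬ (Mono true p.val q.val ω ∧ Mono false p.val q.val ω) := fun h =>
    not_mono_both ω hpq (le_of_lt q.isLt) h.1 h.2
  have nc : ¬ (Mono true q.val (m + 1) ω ∧ Mono false q.val (m + 1) ω) := fun h =>
    not_mono_both ω q.isLt le_rfl h.1 h.2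
  rcases Classical.em (Mono true 0 p.val ω) with ha | ha <;>
    rcases Classical.em (Mono true p.val q.val ω) with hb | hb <;>
    rcases Classical.em (Mono true q.val (m + 1) ω) with hc | hc <;>
    rcases Classical.em (Mono false 0 p.val ω) with ha' | ha' <;>
    rcases Classical.em (Mono false p.val q.val ω) with hb' | hb' <;>
    rcases Classical.em (Mono false q.val (m + 1) ω) with hc' | hc' <;>
    simp_all

include hp hpq in
/-- The sibling's target on the cycle. -/
theorem sibTop_cycle_iff (ω : Fin (m + 1) → Bool) :
    SibTop (cycleHost m) 0 p q (fun _ => EStat.free) ω ↔ topArcs p q ω ∨ arcF p q ω ∨ arcE p q ω := by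
  unfold SibTop
  obtain ⟨h1, h2, h3, h4, _, _⟩ := cycle_atoms p q hp hpq ω
  rw [h1, h2, h3, h4]
  unfold topArcs arcF arcE
  have na : ¬ (Mono true 0 p.val ω ∧ Mono false 0 p.val ω) := fun h =>
    not_mono_both ω hp (by omega) h.1 h.2
  have nb : ¬ (Mono true p.val q.val ω ∧ Mono false p.val q.val ω) := fun h =>
    not_mono_both ω hpq (le_of_lt q.isLt) h.1 h.2
  have nc : ¬ (Mono true q.val (m + 1) ω ∧ Mono false q.val (m + 1) ω) := fun h =>
    not_mono_both ω q.isLt le_rfl h.1 h.2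
  rcases Classical.em (Mono true 0 p.val ω) with ha | ha <;>
    rcases Classical.em (Mono true p.val q.val ω) with hb | hb <;>
    rcases Classical.em (Mono true q.val (m + 1) ω) with hc | hc <;>
    rcases Classical.em (Mono false 0 p.val ω) with ha' | ha' <;>
    rcases Classical.em (Mono false p.val q.val ω) with hb' | hb' <;>
    rcases Classical.em (Mono false q.val (m + 1) ω) with hc' | hc' <;>
    simp_all

/-! ## The sibling flip -/

open Classical in
/-- **THE SIBLING FLIP**: `arcA` flips `c`, `arcC` flips `a`, `arcD` flips `a` and `c`, `arcE` stays. -/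
noncomputable def sibFlip (ω : Fin (m + 1) → Bool) : Fin (m + 1) → Bool :=
  if arcA p q ω then flipArc q.val (m + 1) ω
  else if arcC p q ω then flipArc 0 p.val ω
  else if arcD p q ω then flipArc 0 p.val (flipArc q.val (m + 1) ω)
  else ω

/-- The sibling flip is red-ward. -/
theorem leCol_sibFlip (ω : Fin (m + 1) → Bool) : LeCol ω (sibFlip p q ω) := by
  unfold sibFlip
  split_ifs
  · exact leCol_flipArc _ _ ω
  · exact leCol_flipArc _ _ ω
  · exact (leCol_flipArc _ _ ω).trans (leCol_flipArc _ _ _)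
  · exact LeCol.refl ω

include hp hpq in
/-- The four classes are pairwise exclusive, and the flip on each. -/
theorem sibFlip_cases (ω : Fin (m + 1) → Bool) :
    (arcA p q ω → sibFlip p q ω = flipArc q.val (m + 1) ω) ∧
      (arcC p q ω → sibFlip p q ω = flipArc 0 p.val ω) ∧
      (arcD p q ω → sibFlip p q ω = flipArc 0 p.val (flipArc q.val (m + 1) ω)) ∧
      (arcE p q ω → sibFlip p q ω = ω) := by
  have hq : q.val ≤ m + 1 := le_of_lt q.isLt
  refine ⟨fun hA => ?_, fun hC => ?_, fun hD => ?_, fun hE => ?_⟩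
  · unfold sibFlip; rw [if_pos hA]
  · have hnA : ¬ arcA p q ω := fun hA => hA.2.2.1 hC.1
    unfold sibFlip; rw [if_neg hnA, if_pos hC]
  · have hnA : ¬ arcA p q ω := fun hA => hA.2.2.1 hD.2.1
    have hnC : ¬ arcC p q ω := fun hC => hC.2.2.2 hD.2.2
    unfold sibFlip; rw [if_neg hnA, if_neg hnC, if_pos hD]
  · have hnA : ¬ arcA p q ω := fun hA => hA.2.2.1 hE.2.1
    have hnC : ¬ arcC p q ω := fun hC => hC.2.2.2 hE.2.2
    have hnD : ¬ arcD p q ω := fun hD =>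
      not_mono_both ω hp (le_of_lt (lt_of_lt_of_le hpq hq)) hE.1 hD.1
    unfold sibFlip; rw [if_neg hnA, if_neg hnC, if_neg hnD]

include hp hpq in
/-- The sibling flip of a source lies in the target. -/
theorem sibTop_sibFlip (ω : Fin (m + 1) → Bool) (h : arcA p q ω ∨ arcC p q ω ∨ arcD p q ω ∨ arcE p q ω) :
    topArcs p q (sibFlip p q ω) ∨ arcF p q (sibFlip p q ω) ∨ arcE p q (sibFlip p q ω) := by
  obtain ⟨cA, cC, cD, cE⟩ := sibFlip_cases p q hp hpq ω
  rcases h with hA | hC | hD | hE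
  · rw [cA hA]
    obtain ⟨ha, _, _, hb'⟩ := hA
    refine Or.inl (Or.inr (Or.inl ⟨?_, mono_flipArc _ _ ω, ?_⟩))
    · rwa [mono_flipArc_of_disjoint _ _ _ _ _ ω (Or.inl (le_of_lt hpq))]
    · rwa [mono_flipArc_of_disjoint _ _ _ _ _ ω (Or.inl le_rfl)]
  · rw [cC hC]
    obtain ⟨hb, _, _, hc'⟩ := hC
    refine Or.inl (Or.inl ⟨mono_flipArc _ _ ω, ?_, ?_⟩)
    · rwa [mono_flipArc_of_disjoint _ _ _ _ _ ω (Or.inr le_rfl)]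
    · rwa [mono_flipArc_of_disjoint _ _ _ _ _ ω (Or.inr (le_of_lt hpq))]
  · rw [cD hD]
    obtain ⟨_, hb, _⟩ := hD
    refine Or.inl (Or.inl ⟨mono_flipArc _ _ _, ?_, ?_⟩)
    · rw [mono_flipArc_of_disjoint _ _ _ _ _ _ (Or.inr le_rfl), mono_flipArc_of_disjoint _ _ _ _ _ ω (Or.inl le_rfl)]
      exact hb
    · rw [mono_flipArc_of_disjoint _ _ _ _ _ _ (Or.inr (le_of_lt hpq))]
      exact fun h => not_mono_both _ q.isLt le_rfl (mono_flipArc _ _ ω) h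
  · rw [cE hE]
    exact Or.inr (Or.inr hE)

include hp hpq in
/-- The sibling flip is injective on the sources. -/
theorem sibFlip_injOn :
    Set.InjOn (sibFlip p q) {ω | arcA p q ω ∨ arcC p q ω ∨ arcD p q ω ∨ arcE p q ω} := by
  intro ω₁ h₁ ω₂ h₂ heq
  simp only [Set.mem_setOf_eq] at h₁ h₂
  have hq : q.val ≤ m + 1 := le_of_lt q.isLt
  -- the invariants of the images: A keeps `b` mixed (and has `c` red); C keeps `c` mixed; D is all red; E keeps `c` blue
  have imA : ∀ ω, arcA p q ω → ¬ Mono true p.val q.val (sibFlip p q ω) ∧ Mono true q.val (m + 1) (sibFlip p q ω) := by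
    intro ω hA
    rw [(sibFlip_cases p q hp hpq ω).1 hA, mono_flipArc_of_disjoint _ _ _ _ _ ω (Or.inl le_rfl)]
    exact ⟨hA.2.2.1, mono_flipArc _ _ ω⟩
  have imC : ∀ ω, arcC p q ω → ¬ Mono true q.val (m + 1) (sibFlip p q ω) ∧
      ¬ Mono false q.val (m + 1) (sibFlip p q ω) := by
    intro ω hC
    rw [(sibFlip_cases p q hp hpq ω).2.1 hC, mono_flipArc_of_disjoint _ _ _ _ _ ω (Or.inr (le_of_lt hpq)),
      mono_flipArc_of_disjoint _ _ _ _ _ ω (Or.inr (le_of_lt hpq))]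
    exact ⟨hC.2.2.1, hC.2.2.2⟩
  have imD : ∀ ω, arcD p q ω → Mono true p.val q.val (sibFlip p q ω) ∧ Mono true q.val (m + 1) (sibFlip p q ω) := by
    intro ω hD
    rw [(sibFlip_cases p q hp hpq ω).2.2.1 hD, mono_flipArc_of_disjoint _ _ _ _ _ _ (Or.inr le_rfl),
      mono_flipArc_of_disjoint _ _ _ _ _ ω (Or.inl le_rfl), mono_flipArc_of_disjoint _ _ _ _ _ _ (Or.inr (le_of_lt hpq))]
    exact ⟨hD.2.1, mono_flipArc _ _ ω⟩
  have imE : ∀ ω, arcE p q ω → Mono false q.val (m + 1) (sibFlip p q ω) := by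
    intro ω hE
    rw [(sibFlip_cases p q hp hpq ω).2.2.2 hE]
    exact hE.2.2
  have cnot : ∀ ω, Mono true q.val (m + 1) ω → ¬ Mono false q.val (m + 1) ω :=
    fun ω h h' => not_mono_both ω q.isLt le_rfl h h'
  rcases h₁ with hA₁ | hC₁ | hD₁ | hE₁ <;> rcases h₂ with hA₂ | hC₂ | hD₂ | hE₂
  · rw [(sibFlip_cases p q hp hpq ω₁).1 hA₁, (sibFlip_cases p q hp hpq ω₂).1 hA₂] at heq
    exact flipArc_inj _ _ hA₁.2.1 hA₂.2.1 heq
  · exact absurd (heq ▸ (imA ω₁ hA₁).2) (imC ω₂ hC₂).1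
  · exact absurd (heq ▸ (imD ω₂ hD₂).1) (imA ω₁ hA₁).1
  · exact absurd (heq ▸ (imE ω₂ hE₂)) (cnot _ (imA ω₁ hA₁).2)
  · exact absurd (heq ▸ (imA ω₂ hA₂).2) (imC ω₁ hC₁).1
  · rw [(sibFlip_cases p q hp hpq ω₁).2.1 hC₁, (sibFlip_cases p q hp hpq ω₂).2.1 hC₂] at heq
    exact flipArc_inj _ _ hC₁.2.1 hC₂.2.1 heq
  · exact absurd (heq ▸ (imD ω₂ hD₂).2) (imC ω₁ hC₁).1
  · exact absurd (heq ▸ (imE ω₂ hE₂)) (imC ω₁ hC₁).2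
  · exact absurd (heq ▸ (imA ω₂ hA₂).1) (fun h => h (imD ω₁ hD₁).1)
  · exact absurd (heq ▸ (imD ω₁ hD₁).2) (imC ω₂ hC₂).1
  · rw [(sibFlip_cases p q hp hpq ω₁).2.2.1 hD₁, (sibFlip_cases p q hp hpq ω₂).2.2.1 hD₂] at heq
    have h' := flipArc_inj 0 p.val (by rw [mono_flipArc_of_disjoint _ _ _ _ _ ω₁ (Or.inl (le_of_lt hpq))]; exact hD₁.1)
      (by rw [mono_flipArc_of_disjoint _ _ _ _ _ ω₂ (Or.inl (le_of_lt hpq))]; exact hD₂.1) heq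
    exact flipArc_inj _ _ hD₁.2.2 hD₂.2.2 h'
  · exact absurd (heq ▸ (imE ω₂ hE₂)) (cnot _ (imD ω₁ hD₁).2)
  · exact absurd (heq ▸ (imA ω₂ hA₂).2) (fun h => cnot _ h (imE ω₁ hE₁))
  · exact absurd (heq ▸ (imE ω₁ hE₁)) (imC ω₂ hC₂).2
  · exact absurd (heq ▸ (imD ω₂ hD₂).2) (fun h => cnot _ h (imE ω₁ hE₁))
  · rw [(sibFlip_cases p q hp hpq ω₁).2.2.2 hE₁, (sibFlip_cases p q hp hpq ω₂).2.2.2 hE₂] at heq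
    exact heq

include hp hpq in
open Classical in
/-- **THE SIBLING DOMINATION ON EVERY CYCLE HOST** (marks `0, p`, terminal `q`). -/
theorem sibDominationS_cycle : SibDominationS (cycleHost m) 0 p q (fun _ => EStat.free) := by
  intro V hV
  have key := card_le_of_monotone_injection
    (univ.filter fun ω : Fin (m + 1) → Bool =>
      SibC₁ (cycleHost m) 0 p q (fun _ => EStat.free) ω ∨ SibC₃ (cycleHost m) 0 p q (fun _ => EStat.free) ω)
    (univ.filter fun ω : Fin (m + 1) → Bool => SibTop (cycleHost m) 0 p q (fun _ => EStat.free) ω)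
    (sibFlip p q) (by
      intro ω₁ h₁ ω₂ h₂ heq
      exact sibFlip_injOn p q hp hpq (by simpa [sibSrc_cycle_iff p q hp hpq] using h₁)
        (by simpa [sibSrc_cycle_iff p q hp hpq] using h₂) heq) (by
      intro ω hω
      simp only [Finset.mem_filter, Finset.mem_univ, true_and] at hω ⊢
      rw [sibSrc_cycle_iff p q hp hpq] at hω
      exact ⟨(sibTop_cycle_iff p q hp hpq _).mpr (sibTop_sibFlip p q hp hpq ω hω), leCol_sibFlip p q ω⟩) V hV
  simp only [Finset.filter_filter] at key
  exact (card_filter_congr' fun _ _ => and_comm).trans_le (key.trans_eq (card_filter_congr' fun _ _ => and_comm))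

end MultiExit

end ZoneZ

end PercRepro
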